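/-
Copyright (c) 2026 the pub-hodgecm-mathlib formalisation cell (harness21).  Prover seat hodgecm-mathlib-K2E1-p11 (g6), Track B ∕ K2-LIT, h413 = `stmt-HodgeConjecture-24833`,
R90-TF section S8 «ContSpec-n½», the `hsrc` supplier estate, RULING J-S8-ω (S8 dealer R90-CS-plan (g4), S8-R313 (c) «ONE DEFINITION, TWO COROLLARIES»), FILE (α): THE DESCRIPTIVE
WEIGHT — for ANY finite factor `Φf` with the (supp-on)∕(supp-off) law at `(χ, 1, K_f(𝔫))` and ANY finite translate `k_f`, the weight `ω^{(k)}_v(x|_v) := Φf(inclPlace_v((ι(w₀)·n(x)·k)_v))`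
(the finite factor READ AT THE SINGLE-PLACE ELEMENT of the big-cell component) EXISTS as a function of `x|_v` alone and satisfies ★ p864965's per-place dichotomy BY CONSTRUCTION,
hence the pure-tensor letter `hΩ` for EVERY `k_f` — no matrix reading needed.
-/
import Summits.HodgeConjecture.HodgeConjecture.Theorems.K2E1ChiBadPlaceReadingU3        -- ★ p865059 (this seat): `snd_quadraticFiniteAdeleMap_apply_placesOver`, `conjAdele_snd_apply_placesOver`; brings ★ p865012 `coe_evalPlace_finPart_weylLongU_mul_heisChart_mul`, ★ p864965 `hΩ_of_localReadings` & readings, ★ p864759 dictionary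
import Literature.NumberTheory.Automorphic.UnitaryGroupPlaceInclusion                   -- ★ `inclPlace v : U(F_v) →* U(𝔸_{F,f})`, `evalPlace_inclPlace`, `evalPlace_inclPlace_of_ne`
import HarnessLib

/-!
# K2·E1 ∕ R90·S8 — `K2E1ChiDescriptiveWeightU3` (RULING J-S8-ω, FILE (α)): THE DESCRIPTIVE WEIGHT `ω^{(k)}_v` OF A FINITE LEVEL FACTOR AND ITS PURE-TENSOR LETTER `hΩ` FOR EVERY
# FINITE TRANSLATE `k_f`

Cell `pub/hodgecm-mathlib`, crux h413 = `stmt-HodgeConjecture-24833`, route of record `HCCMUnconditional`; R90-TF section S8 «ContSpec-n½», (V-1) rows `hunfK` (★ p865409's nine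
per-`k` rows) and `hsrc` (★ p864821's six rows): their common weight letter `ω` (RULING J-S8-ω: «one definition, two corollaries»).  THEOREMS ONLY (no `def`, no `instance`, no `notation`,
no named-fact hypothesis, no `sorry`; default heartbeats); lane `--supports stmt-HodgeConjecture-24833 --as helper` (count-neutral).  Closes no socket.

THE MATHEMATICS ([PlatonovRapinchuk1994] §5.1; [BorelJacquet1979] §4.1; [MoeglinWaldspurger1995] I.2.17, II.1.6; [Rogawski1990] §4.5 p. 45).  Let `Φf : U(2,1)(𝔸_{L⁺,f}) → ℂ` satisfy the
finite-level law at `(χ, 1, K_f(𝔫))`: `Φf(b·k) = χ(b₀₀)` for `ι_f b ∈ B(𝔸)`, `k ∈ K_f(𝔫)` (supp-on) and `Φf(u) = 0` off `B_f·K_f(𝔫)` (supp-off) (★ (E-supp); the untwisted witness's finite part).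
For a finite place `v` of `L⁺` let `ι^{(v)} : U(L⁺_v) → U(𝔸_{L⁺,f})` be the single-place inclusion (★ `inclPlace v`).  For `g ∈ U(L⁺_v)`: if `g = β·κ` with `β` upper triangular at every `w ∣ v` and
`κ_w ∈ K_w(|𝔫|_w)`, then `ι^{(v)}β ∈ B_f` and `ι^{(v)}κ ∈ K_f(𝔫)` (the other components are `1`), so **`Φf(ι^{(v)}g) = ∏_{w∣v} χ_w((β_w)₀₀)`** (★ p864965 `finLevelSection_apply_eq_finprod_of_local` at
the place-`v` Iwasawa family `(β, κ; 1, 1, …)`); if `g ∉ B_v·K_v(𝔫)` then `ι^{(v)}g ∉ B_f·K_f(𝔫)` and **`Φf(ι^{(v)}g) = 0`** (★ `finLevelSection_apply_eq_zero_of_local_off`); if `g_w ∈ K_w(|𝔫|_w)` for all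
`w ∣ v` then `Φf(ι^{(v)}g) = 1`.  The big-cell component `(ι(w₀)·n(x)·k_f)_v` depends on `x ∈ (𝔸_{L⁺,f})³` only through `x|_v` (★ p865012's matrix reading, entries `Ψ_v(x₀|_v, x₁|_v)_w`,
`σ(…)_w`, `Z(x|_v)_w`), and every `p ∈ (L⁺_v)³` is `x|_v` for the single-place adele `x = (…, 0, p, 0, …)` (Mathlib `RestrictedProduct.single`).  HENCE THE DESCRIPTIVE WEIGHT
**`ω^{(k)}_v(p) := Φf(ι^{(v)}((ι(w₀)·n(x)·k_f)_v))`, `x|_v = p`** is a well-defined function of `p`, and ★ p864965 `hΩ_of_localReadings`' per-place dichotomy holds for it BY CONSTRUCTION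
(`by_cases` on the local Iwasawa membership; finite support from ★ `eventually_forall_evalPlace_mem_valuedCongruenceSubgroup`, `𝔫 ≠ 0`): **`Φf((ι(w₀)·n(x))_f·k_f) = ∏ᶠ_v ω^{(k)}_v(x|_v)`
for EVERY `k_f` and every `x`** — ★ p865409's row `hΩ` (all `k`) and ★ p864821's letter `hΩ` (`k_f := b₁`) at once, for the untwisted factor.
* §1 `evalPlace_bigCell_congr` (the component at `v` depends only on `x|_v`), `exists_finiteAdele_apply_eq` (every `p` is some `x|_v`).
* §2 the descriptive readings at single-place elements: `apply_inclPlace_eq_prod_of_eq_mul` (on), `apply_inclPlace_eq_zero_of_forall_ne` (off), `apply_inclPlace_eq_one_of_mem_level` (unit).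
* §3 **`exists_descriptiveWeight`** (the family `ω^{(k)}`, all `k_f` at once, with its defining equation) and HEAD **`hΩ_of_descriptiveWeight`** (the pure-tensor letter for every `k_f`).
HONEST LABEL: HC_CM is proved only modulo the 7 printed citations (2 remaining named inputs: hLiu418 = `stmt-HodgeConjecture-24832`, h413 = `stmt-HodgeConjecture-24833`) until rung 0
closes; REL ≠ ★ ≠ BUILT; unconditional; asserts no named fact, closes no socket; FILE (α) of five ((β) continuity∕measurability∕bounds, (γ) tokens via ★ p865184 ∕ ★ p865482 identification,
(δ) integrability rows, (ε) the two heads); count-neutral.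

## References
* [PlatonovRapinchuk1994] V. Platonov, A. Rapinchuk, *Algebraic Groups and Number Theory* (1994), §5.1.
* [BorelJacquet1979] A. Borel, H. Jacquet, *Automorphic forms and automorphic representations*, PSPM 33.1 (1979), §4.1.
* [MoeglinWaldspurger1995] C. Mœglin, J.-L. Waldspurger, *Spectral Decomposition and Eisenstein Series* (1995), I.2.17, II.1.6.
* [Rogawski1990] J. D. Rogawski, *Automorphic Representations of Unitary Groups in Three Variables*, Ann. of Math. Stud. 123 (1990), §4.5 p. 45.
* [GetzHahn2024] J. Getz, H. Hahn, *An Introduction to Automorphic Representations* (2024), Prop. 2.3.1.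
-/

set_option autoImplicit false
set_option linter.dupNamespace false  -- the mandated namespace repeats the summit's segment (`HodgeConjecture.HodgeConjecture`)

noncomputable section

open NumberField IsDedekindDomain Filter Set Function
open scoped RestrictedProduct
open Literature.NumberTheory.GaloisRepresentations Literature.NumberTheory.GaloisRepresentations.HeckeCharacter
open Literature.NumberTheory.Automorphic Literature.NumberTheory.Automorphic.UnitaryGroup AdelicGroupData
open Literature.NumberTheory.Automorphic.Arthur2013.Leaves.TECR
open Summit.HodgeConjecture.HodgeConjecture.Cruxes.H413.K2E1CharacterEisensteinU2Defs
open Summit.HodgeConjecture.HodgeConjecture.Cruxes.H413.K2E1CharacterEisensteinU3PairDefs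
open Summit.HodgeConjecture.HodgeConjecture.Cruxes.H413.K2E1ChiMidBlockUnfoldingLetterFreeU3 (apply_diag_ne_zero_of_blockTriangular finLevelSection_apply_eq_finprod_of_local finLevelSection_apply_eq_zero_of_local_off hΩ_of_localReadings)
open Summit.HodgeConjecture.HodgeConjecture.Cruxes.H413.K2E1ChiFinReadingEntriesU3 (coe_evalPlace_finPart_weylLongU_mul_heisChart_mul)
open Summit.HodgeConjecture.HodgeConjecture.Cruxes.H413.K2E1ChiBadPlaceReadingU3 (snd_quadraticFiniteAdeleMap_apply_placesOver conjAdele_snd_apply_placesOver)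
open Summit.HodgeConjecture.HodgeConjecture.Cruxes.H413.K2E1IntertwiningFiniteHeightDictionaryU3 (heisZ_snd_apply_placesOver)
open Summit.HodgeConjecture.HodgeConjecture.Cruxes.H413.K2E1FinAdelicBorelLevelLocalGlobalU3 (eventually_forall_evalPlace_mem_valuedCongruenceSubgroup)

namespace Summit.HodgeConjecture.HodgeConjecture.Cruxes.H413.K2E1ChiDescriptiveWeightU3

variable (L : Type) [Field L] [NumberField L] [IsCMField L]

/-! ## §1 The big-cell component at `v` depends only on `x|_v`; every `p ∈ (L⁺_v)³` is some `x|_v` -/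

section Component

variable (hc : IsCMField.complexConj L * IsCMField.complexConj L = 1) {δ : L} (hcδ : IsCMField.complexConj L δ = -δ) (hδ : δ ≠ 0)

/-- **The component of the big cell `(ι(w₀)·n(x))_f·k_f` at `v` depends on `x` only through `x|_v`** (★ p865012's matrix reading: the entries at `w ∣ v` are `Ψ_v(x₀|_v, x₁|_v)_w`, its conjugate,
and `Z(x|_v)_w`). [cite: Rogawski1990, §4.5 p. 45] [cite: PlatonovRapinchuk1994, §5.1] -/
theorem evalPlace_bigCell_congr (kf : ↥(finAdelic (↥(maximalRealSubfield L)) L (IsCMField.complexConj L) 3 ((StdForm.antidiagonal 3).over L))) (v : HeightOneSpectrum (𝓞 ↥(maximalRealSubfield L)))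
    {x x' : Fin 3 → FiniteAdeleRing (𝓞 ↥(maximalRealSubfield L)) ↥(maximalRealSubfield L)} (hx : ∀ i, x i v = x' i v) :
    evalPlace (↥(maximalRealSubfield L)) L (IsCMField.complexConj L) 3 ((StdForm.antidiagonal 3).over L) v
        (finPart (↥(maximalRealSubfield L)) L (IsCMField.complexConj L) 3 ((StdForm.antidiagonal 3).over L)
          ((quasiSplit (↥(maximalRealSubfield L)) L (IsCMField.complexConj L) 3).toAdelic (weylLongU ((IsCMField.complexConj L : L ≃ₐ[↥(maximalRealSubfield L)] L) : L →+* L) (rfl : (StdForm.antidiagonal 3).over L = (StdForm.antidiagonal 3).over L)) *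
            ((heisChart hc (((((0 : InfiniteAdeleRing L)), quadraticFiniteAdeleMap ↥(maximalRealSubfield L) L δ (x 0, x 1)) : AdeleRing (𝓞 L) L),
              traceZeroLine ↥(maximalRealSubfield L) L (IsCMField.complexConj L) hcδ hδ ((0, x 2) : AdeleRing (𝓞 ↥(maximalRealSubfield L)) ↥(maximalRealSubfield L))) :
                ↥(adelicUnipotent ↥(maximalRealSubfield L) L (IsCMField.complexConj L) 3)) : (quasiSplit (↥(maximalRealSubfield L)) L (IsCMField.complexConj L) 3).Adelic)) * kf) =
      evalPlace (↥(maximalRealSubfield L)) L (IsCMField.complexConj L) 3 ((StdForm.antidiagonal 3).over L) v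
        (finPart (↥(maximalRealSubfield L)) L (IsCMField.complexConj L) 3 ((StdForm.antidiagonal 3).over L)
          ((quasiSplit (↥(maximalRealSubfield L)) L (IsCMField.complexConj L) 3).toAdelic (weylLongU ((IsCMField.complexConj L : L ≃ₐ[↥(maximalRealSubfield L)] L) : L →+* L) (rfl : (StdForm.antidiagonal 3).over L = (StdForm.antidiagonal 3).over L)) *
            ((heisChart hc (((((0 : InfiniteAdeleRing L)), quadraticFiniteAdeleMap ↥(maximalRealSubfield L) L δ (x' 0, x' 1)) : AdeleRing (𝓞 L) L),
              traceZeroLine ↥(maximalRealSubfield L) L (IsCMField.complexConj L) hcδ hδ ((0, x' 2) : AdeleRing (𝓞 ↥(maximalRealSubfield L)) ↥(maximalRealSubfield L))) :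
                ↥(adelicUnipotent ↥(maximalRealSubfield L) L (IsCMField.complexConj L) 3)) : (quasiSplit (↥(maximalRealSubfield L)) L (IsCMField.complexConj L) 3).Adelic)) * kf) := by
  refine Subtype.ext (funext fun w => Units.ext ?_)
  rw [coe_evalPlace_finPart_weylLongU_mul_heisChart_mul L hc, coe_evalPlace_finPart_weylLongU_mul_heisChart_mul L hc,
    conjAdele_snd_apply_placesOver L hcδ hδ x v w, snd_quadraticFiniteAdeleMap_apply_placesOver L hcδ hδ x v w,
    heisZ_snd_apply_placesOver L hcδ hδ (0 : InfiniteAdeleRing L) (x 0) (x 1) (x 2) v w,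
    conjAdele_snd_apply_placesOver L hcδ hδ x' v w, snd_quadraticFiniteAdeleMap_apply_placesOver L hcδ hδ x' v w,
    heisZ_snd_apply_placesOver L hcδ hδ (0 : InfiniteAdeleRing L) (x' 0) (x' 1) (x' 2) v w, hx 0, hx 1, hx 2]

omit [IsCMField L] in
/-- **Every `p ∈ (L⁺_v)³` is the `v`-component of a finite adele triple** (the single-place adeles `(…, 0, pᵢ, 0, …)`, Mathlib `RestrictedProduct.single`). [cite: PlatonovRapinchuk1994, §5.1] -/
theorem exists_finiteAdele_apply_eq (v : HeightOneSpectrum (𝓞 ↥(maximalRealSubfield L))) (p : Fin 3 → v.adicCompletion ↥(maximalRealSubfield L)) :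
    ∃ x : Fin 3 → FiniteAdeleRing (𝓞 ↥(maximalRealSubfield L)) ↥(maximalRealSubfield L), ∀ i, x i v = p i := by
  classical
  exact ⟨fun i => RestrictedProduct.single (fun u : HeightOneSpectrum (𝓞 ↥(maximalRealSubfield L)) => u.adicCompletionIntegers ↥(maximalRealSubfield L)) v (p i),
    fun i => RestrictedProduct.single_eq_same _ v (p i)⟩

end Component

/-! ## §2 The finite factor read at single-place elements -/

section Reading

variable (χ : HeckeCharacter L) (𝔫 : Ideal (𝓞 L)) (Φf : ↥(finAdelic (↥(maximalRealSubfield L)) L (IsCMField.complexConj L) 3 ((StdForm.antidiagonal 3).over L)) → ℂ)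
  (v : HeightOneSpectrum (𝓞 ↥(maximalRealSubfield L)))

/-- **«ON» AT A SINGLE-PLACE ELEMENT: `Φf(ι^{(v)}(β·κ)) = ∏_{w∣v} χ_w((β_w)₀₀)`** for `β` upper triangular at every `w ∣ v` and `κ_w ∈ K_w(|𝔫|_w)` — ★ p864965's «on» reading at the place-`v`
Iwasawa family `(β, κ; 1, 1, …)` (the other components of `ι^{(v)}(β·κ)` are `1 = 1·1`), the finite product collapsing to its `v`-factor (`χ_w(1) = 1`). [cite: BorelJacquet1979, §4.1]
[cite: PlatonovRapinchuk1994, §5.1] [cite: MoeglinWaldspurger1995, I.2.17] -/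
theorem apply_inclPlace_eq_prod_of_eq_mul
    (hon : ∀ (b k : ↥(finAdelic (↥(maximalRealSubfield L)) L (IsCMField.complexConj L) 3 ((StdForm.antidiagonal 3).over L)))
        (hb : finAdelicToAdelic (↥(maximalRealSubfield L)) L (IsCMField.complexConj L) 3 ((StdForm.antidiagonal 3).over L) b ∈ borelAdelic (↥(maximalRealSubfield L)) L (IsCMField.complexConj L) 3),
        k ∈ finCongruenceLevel (↥(maximalRealSubfield L)) L (IsCMField.complexConj L) 3 ((StdForm.antidiagonal 3).over L) 𝔫 →
        Φf (b * k) = ((χ (firstEntryUnit hb) : ℂˣ) : ℂ) * (((1 : ↥(TorusDict.torus (IsCMField.complexConj L)) →ₜ* ℂˣ) (middleEntryUnitary hb) : ℂˣ) : ℂ))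
    {g : localPi L (IsCMField.complexConj L) 3 ((StdForm.antidiagonal 3).over L) v} (β κ : localPi L (IsCMField.complexConj L) 3 ((StdForm.antidiagonal 3).over L) v)
    (hβ : ∀ w : PlacesOver L v, ((((β : localPi L (IsCMField.complexConj L) 3 ((StdForm.antidiagonal 3).over L) v) : LocalGLPi L 3 v) w : GL (Fin 3) (w.1.adicCompletion L)) :
      Matrix (Fin 3) (Fin 3) (w.1.adicCompletion L)).BlockTriangular id)
    (hκ : ∀ w : PlacesOver L v, ((κ : localPi L (IsCMField.complexConj L) 3 ((StdForm.antidiagonal 3).over L) v) : LocalGLPi L 3 v) w ∈ valuedCongruenceSubgroup (Fin 3) (idealRadius L w.1 𝔫))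
    (hg : g = β * κ) (t : ∀ w : PlacesOver L v, (w.1.adicCompletion L)ˣ)
    (ht : ∀ w : PlacesOver L v, ((t w : (w.1.adicCompletion L)ˣ) : w.1.adicCompletion L) =
      ((((β : localPi L (IsCMField.complexConj L) 3 ((StdForm.antidiagonal 3).over L) v) : LocalGLPi L 3 v) w : GL (Fin 3) (w.1.adicCompletion L)) : Matrix (Fin 3) (Fin 3) (w.1.adicCompletion L)) 0 0) :
    Φf (inclPlace (↥(maximalRealSubfield L)) L (IsCMField.complexConj L) 3 ((StdForm.antidiagonal 3).over L) v g) = ∏ w : PlacesOver L v, ((χ.localComponent w.1 (t w) : ℂˣ) : ℂ) := by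
  classical
  -- the place-`v` Iwasawa family `(β, κ, t; 1, 1, 1, …)`
  set β' : ∀ v' : HeightOneSpectrum (𝓞 ↥(maximalRealSubfield L)), localPi L (IsCMField.complexConj L) 3 ((StdForm.antidiagonal 3).over L) v' := Function.update (fun _ => 1) v β with hβ'
  set κ' : ∀ v' : HeightOneSpectrum (𝓞 ↥(maximalRealSubfield L)), localPi L (IsCMField.complexConj L) 3 ((StdForm.antidiagonal 3).over L) v' := Function.update (fun _ => 1) v κ with hκ'
  set t' : ∀ (v' : HeightOneSpectrum (𝓞 ↥(maximalRealSubfield L))) (w : PlacesOver L v'), (w.1.adicCompletion L)ˣ := Function.update (fun _ _ => 1) v t with ht'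
  have hone : ∀ (v' : HeightOneSpectrum (𝓞 ↥(maximalRealSubfield L))) (w : PlacesOver L v'),
      ((((1 : localPi L (IsCMField.complexConj L) 3 ((StdForm.antidiagonal 3).over L) v') : LocalGLPi L 3 v') w : GL (Fin 3) (w.1.adicCompletion L)) : Matrix (Fin 3) (Fin 3) (w.1.adicCompletion L)) = 1 :=
    fun v' w => by rw [OneMemClass.coe_one, Pi.one_apply, Units.val_one]
  have key := finLevelSection_apply_eq_finprod_of_local L χ 𝔫 Φf hon (inclPlace (↥(maximalRealSubfield L)) L (IsCMField.complexConj L) 3 ((StdForm.antidiagonal 3).over L) v g) β' κ'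
    (fun v' w => by
      by_cases h : v' = v
      · subst h
        rw [hβ', Function.update_self]
        exact hβ w
      · rw [hβ', Function.update_of_ne h, hone]
        exact Matrix.blockTriangular_one)
    (fun v' w => by
      by_cases h : v' = v
      · subst h
        rw [hκ', Function.update_self]
        exact hκ w
      · rw [hκ', Function.update_of_ne h, OneMemClass.coe_one, Pi.one_apply]
        exact one_mem _)
    (fun v' => by
      by_cases h : v' = v
      · subst h
        rw [hβ', hκ', Function.update_self, Function.update_self, evalPlace_inclPlace, hg]
      · rw [hβ', hκ', Function.update_of_ne h, Function.update_of_ne h, evalPlace_inclPlace_of_ne (↥(maximalRealSubfield L)) L (IsCMField.complexConj L) 3 _ h, one_mul])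
    t' (fun v' w => by
      by_cases h : v' = v
      · subst h
        rw [ht', hβ', Function.update_self, Function.update_self]
        exact ht w
      · rw [ht', hβ', Function.update_of_ne h, Function.update_of_ne h, hone, Matrix.one_apply_eq, Units.val_one])
  rw [key, finprod_eq_single _ v (fun v' hv' => by
    rw [ht', Function.update_of_ne hv']
    exact Finset.prod_eq_one fun w _ => by rw [map_one, Units.val_one])]
  rw [ht', Function.update_self]

/-- **«OFF» AT A SINGLE-PLACE ELEMENT: `Φf(ι^{(v)}g) = 0` when `g ∉ B_v·K_v(𝔫)`** (★ `finLevelSection_apply_eq_zero_of_local_off` at the place `v`, `(ι^{(v)}g)_v = g`).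
[cite: PlatonovRapinchuk1994, §5.1] [cite: BorelJacquet1979, §4.1] -/
theorem apply_inclPlace_eq_zero_of_forall_ne
    (hoff : ∀ u : ↥(finAdelic (↥(maximalRealSubfield L)) L (IsCMField.complexConj L) 3 ((StdForm.antidiagonal 3).over L)),
      (∀ (b k : ↥(finAdelic (↥(maximalRealSubfield L)) L (IsCMField.complexConj L) 3 ((StdForm.antidiagonal 3).over L))),
          finAdelicToAdelic (↥(maximalRealSubfield L)) L (IsCMField.complexConj L) 3 ((StdForm.antidiagonal 3).over L) b ∈ borelAdelic (↥(maximalRealSubfield L)) L (IsCMField.complexConj L) 3 →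
            k ∈ finCongruenceLevel (↥(maximalRealSubfield L)) L (IsCMField.complexConj L) 3 ((StdForm.antidiagonal 3).over L) 𝔫 → u ≠ b * k) → Φf u = 0)
    {g : localPi L (IsCMField.complexConj L) 3 ((StdForm.antidiagonal 3).over L) v}
    (hg : ∀ β κ : localPi L (IsCMField.complexConj L) 3 ((StdForm.antidiagonal 3).over L) v,
      (∀ w : PlacesOver L v, ((((β : localPi L (IsCMField.complexConj L) 3 ((StdForm.antidiagonal 3).over L) v) : LocalGLPi L 3 v) w : GL (Fin 3) (w.1.adicCompletion L)) :
        Matrix (Fin 3) (Fin 3) (w.1.adicCompletion L)).BlockTriangular id) →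
      (∀ w : PlacesOver L v, ((κ : localPi L (IsCMField.complexConj L) 3 ((StdForm.antidiagonal 3).over L) v) : LocalGLPi L 3 v) w ∈ valuedCongruenceSubgroup (Fin 3) (idealRadius L w.1 𝔫)) →
      g ≠ β * κ) :
    Φf (inclPlace (↥(maximalRealSubfield L)) L (IsCMField.complexConj L) 3 ((StdForm.antidiagonal 3).over L) v g) = 0 :=
  finLevelSection_apply_eq_zero_of_local_off L 𝔫 Φf hoff _ (v := v) fun β κ hβ hκ => by
    rw [evalPlace_inclPlace]
    exact hg β κ hβ hκ

/-- **THE UNIT CASE: `Φf(ι^{(v)}g) = 1` when `g_w ∈ K_w(|𝔫|_w)` for every `w ∣ v`** (§2 «on» with `β = 1`, `t = 1`). [cite: PlatonovRapinchuk1994, §5.1] -/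
theorem apply_inclPlace_eq_one_of_mem_level
    (hon : ∀ (b k : ↥(finAdelic (↥(maximalRealSubfield L)) L (IsCMField.complexConj L) 3 ((StdForm.antidiagonal 3).over L)))
        (hb : finAdelicToAdelic (↥(maximalRealSubfield L)) L (IsCMField.complexConj L) 3 ((StdForm.antidiagonal 3).over L) b ∈ borelAdelic (↥(maximalRealSubfield L)) L (IsCMField.complexConj L) 3),
        k ∈ finCongruenceLevel (↥(maximalRealSubfield L)) L (IsCMField.complexConj L) 3 ((StdForm.antidiagonal 3).over L) 𝔫 →
        Φf (b * k) = ((χ (firstEntryUnit hb) : ℂˣ) : ℂ) * (((1 : ↥(TorusDict.torus (IsCMField.complexConj L)) →ₜ* ℂˣ) (middleEntryUnitary hb) : ℂˣ) : ℂ))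
    {g : localPi L (IsCMField.complexConj L) 3 ((StdForm.antidiagonal 3).over L) v}
    (hg : ∀ w : PlacesOver L v, ((g : localPi L (IsCMField.complexConj L) 3 ((StdForm.antidiagonal 3).over L) v) : LocalGLPi L 3 v) w ∈ valuedCongruenceSubgroup (Fin 3) (idealRadius L w.1 𝔫)) :
    Φf (inclPlace (↥(maximalRealSubfield L)) L (IsCMField.complexConj L) 3 ((StdForm.antidiagonal 3).over L) v g) = 1 := by
  rw [apply_inclPlace_eq_prod_of_eq_mul L χ 𝔫 Φf v hon 1 g (fun w => by rw [OneMemClass.coe_one, Pi.one_apply, Units.val_one]; exact Matrix.blockTriangular_one) hg (one_mul g).symm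
    (fun _ => 1) (fun w => by rw [OneMemClass.coe_one, Pi.one_apply, Units.val_one, Units.val_one, Matrix.one_apply_eq])]
  exact Finset.prod_eq_one fun w _ => by rw [map_one, Units.val_one]

end Reading

/-! ## §3 The descriptive weight family and its pure-tensor letter `hΩ` for every finite translate -/

section Descriptive

variable (hc : IsCMField.complexConj L * IsCMField.complexConj L = 1) {δ : L} (hcδ : IsCMField.complexConj L δ = -δ) (hδ : δ ≠ 0)

/-- **THE DESCRIPTIVE WEIGHT FAMILY EXISTS**: for any finite factor `Φf` there is ONE family `ω : k_f ↦ (v ↦ ω^{(k)}_v)`, `ω^{(k)}_v : (L⁺_v)³ → ℂ`, with the DEFINING EQUATION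
`ω^{(k)}_v(x|_v) = Φf(ι^{(v)}((ι(w₀)·n(x))_f·k_f)_v)` for every `k_f`, `v`, `x` (§1: the right side depends on `x` only through `x|_v`, and every `p` is some `x|_v`). [cite: PlatonovRapinchuk1994, §5.1]
[cite: Rogawski1990, §4.5 p. 45] -/
theorem exists_descriptiveWeight (Φf : ↥(finAdelic (↥(maximalRealSubfield L)) L (IsCMField.complexConj L) 3 ((StdForm.antidiagonal 3).over L)) → ℂ) :
    ∃ ω : ↥(finAdelic (↥(maximalRealSubfield L)) L (IsCMField.complexConj L) 3 ((StdForm.antidiagonal 3).over L)) →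
        ∀ v : HeightOneSpectrum (𝓞 ↥(maximalRealSubfield L)), (Fin 3 → v.adicCompletion ↥(maximalRealSubfield L)) → ℂ,
      ∀ (kf : ↥(finAdelic (↥(maximalRealSubfield L)) L (IsCMField.complexConj L) 3 ((StdForm.antidiagonal 3).over L))) (v : HeightOneSpectrum (𝓞 ↥(maximalRealSubfield L)))
        (x : Fin 3 → FiniteAdeleRing (𝓞 ↥(maximalRealSubfield L)) ↥(maximalRealSubfield L)),
        ω kf v (fun i => x i v) = Φf (inclPlace (↥(maximalRealSubfield L)) L (IsCMField.complexConj L) 3 ((StdForm.antidiagonal 3).over L) v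
          (evalPlace (↥(maximalRealSubfield L)) L (IsCMField.complexConj L) 3 ((StdForm.antidiagonal 3).over L) v
            (finPart (↥(maximalRealSubfield L)) L (IsCMField.complexConj L) 3 ((StdForm.antidiagonal 3).over L)
              ((quasiSplit (↥(maximalRealSubfield L)) L (IsCMField.complexConj L) 3).toAdelic (weylLongU ((IsCMField.complexConj L : L ≃ₐ[↥(maximalRealSubfield L)] L) : L →+* L) (rfl : (StdForm.antidiagonal 3).over L = (StdForm.antidiagonal 3).over L)) *
                ((heisChart hc (((((0 : InfiniteAdeleRing L)), quadraticFiniteAdeleMap ↥(maximalRealSubfield L) L δ (x 0, x 1)) : AdeleRing (𝓞 L) L),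
                  traceZeroLine ↥(maximalRealSubfield L) L (IsCMField.complexConj L) hcδ hδ ((0, x 2) : AdeleRing (𝓞 ↥(maximalRealSubfield L)) ↥(maximalRealSubfield L))) :
                    ↥(adelicUnipotent ↥(maximalRealSubfield L) L (IsCMField.complexConj L) 3)) : (quasiSplit (↥(maximalRealSubfield L)) L (IsCMField.complexConj L) 3).Adelic)) * kf))) := by
  classical
  have H := fun (v : HeightOneSpectrum (𝓞 ↥(maximalRealSubfield L))) (p : Fin 3 → v.adicCompletion ↥(maximalRealSubfield L)) => exists_finiteAdele_apply_eq L v p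
  choose xh hxh using H
  refine ⟨fun kf v p => Φf (inclPlace (↥(maximalRealSubfield L)) L (IsCMField.complexConj L) 3 ((StdForm.antidiagonal 3).over L) v
    (evalPlace (↥(maximalRealSubfield L)) L (IsCMField.complexConj L) 3 ((StdForm.antidiagonal 3).over L) v
      (finPart (↥(maximalRealSubfield L)) L (IsCMField.complexConj L) 3 ((StdForm.antidiagonal 3).over L)
        ((quasiSplit (↥(maximalRealSubfield L)) L (IsCMField.complexConj L) 3).toAdelic (weylLongU ((IsCMField.complexConj L : L ≃ₐ[↥(maximalRealSubfield L)] L) : L →+* L) (rfl : (StdForm.antidiagonal 3).over L = (StdForm.antidiagonal 3).over L)) *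
          ((heisChart hc (((((0 : InfiniteAdeleRing L)), quadraticFiniteAdeleMap ↥(maximalRealSubfield L) L δ (xh v p 0, xh v p 1)) : AdeleRing (𝓞 L) L),
            traceZeroLine ↥(maximalRealSubfield L) L (IsCMField.complexConj L) hcδ hδ ((0, xh v p 2) : AdeleRing (𝓞 ↥(maximalRealSubfield L)) ↥(maximalRealSubfield L))) :
              ↥(adelicUnipotent ↥(maximalRealSubfield L) L (IsCMField.complexConj L) 3)) : (quasiSplit (↥(maximalRealSubfield L)) L (IsCMField.complexConj L) 3).Adelic)) * kf))), fun kf v x => ?_⟩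
  -- the defining equation: `x̂|_v = x|_v`
  show Φf _ = Φf _
  rw [evalPlace_bigCell_congr L hc hcδ hδ kf v (x := xh v (fun i => x i v)) (x' := x) (fun i => hxh v _ i)]

/-- **HEAD — THE PURE-TENSOR LETTER `hΩ` OF THE DESCRIPTIVE WEIGHT, FOR EVERY FINITE TRANSLATE `k_f`.**  For a finite factor `Φf` with the (supp-on)∕(supp-off) law at `(χ, 1, K_f(𝔫))`, `𝔫 ≠ 0`,
and a weight `ω_v` satisfying the defining equation of `ω^{(k)}` at `k_f`: **`Φf((ι(w₀)·n(x))_f·k_f) = ∏ᶠ_v ω_v(x|_v)` for every `x`** — ★ p864965 `hΩ_of_localReadings`, its per-place dichotomy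
holding BY CONSTRUCTION (§2 «on» ∕ «off» at the single-place element; finite support: `(ι(w₀)·n(x)·k_f)_v ∈ K_v(|𝔫|_v) = 𝒦` for almost all `v`, ★ `eventually_forall_evalPlace_mem_valuedCongruenceSubgroup`,
and there `ω_v = 1` by §2's unit case).  This is ★ p865409's row `hΩ` (all `k`) and ★ p864821's letter `hΩ` (`k_f := b₁`) for the untwisted factor. [cite: PlatonovRapinchuk1994, §5.1]
[cite: BorelJacquet1979, §4.1] [cite: MoeglinWaldspurger1995, I.2.17, II.1.6] [cite: Rogawski1990, §4.5 p. 45] -/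
theorem hΩ_of_descriptiveWeight (χ : HeckeCharacter L) {𝔫 : Ideal (𝓞 L)} (h𝔫 : 𝔫 ≠ 0)
    (Φf : ↥(finAdelic (↥(maximalRealSubfield L)) L (IsCMField.complexConj L) 3 ((StdForm.antidiagonal 3).over L)) → ℂ)
    (hon : ∀ (b k : ↥(finAdelic (↥(maximalRealSubfield L)) L (IsCMField.complexConj L) 3 ((StdForm.antidiagonal 3).over L)))
        (hb : finAdelicToAdelic (↥(maximalRealSubfield L)) L (IsCMField.complexConj L) 3 ((StdForm.antidiagonal 3).over L) b ∈ borelAdelic (↥(maximalRealSubfield L)) L (IsCMField.complexConj L) 3),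
        k ∈ finCongruenceLevel (↥(maximalRealSubfield L)) L (IsCMField.complexConj L) 3 ((StdForm.antidiagonal 3).over L) 𝔫 →
        Φf (b * k) = ((χ (firstEntryUnit hb) : ℂˣ) : ℂ) * (((1 : ↥(TorusDict.torus (IsCMField.complexConj L)) →ₜ* ℂˣ) (middleEntryUnitary hb) : ℂˣ) : ℂ))
    (hoff : ∀ u : ↥(finAdelic (↥(maximalRealSubfield L)) L (IsCMField.complexConj L) 3 ((StdForm.antidiagonal 3).over L)),
      (∀ (b k : ↥(finAdelic (↥(maximalRealSubfield L)) L (IsCMField.complexConj L) 3 ((StdForm.antidiagonal 3).over L))),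
          finAdelicToAdelic (↥(maximalRealSubfield L)) L (IsCMField.complexConj L) 3 ((StdForm.antidiagonal 3).over L) b ∈ borelAdelic (↥(maximalRealSubfield L)) L (IsCMField.complexConj L) 3 →
            k ∈ finCongruenceLevel (↥(maximalRealSubfield L)) L (IsCMField.complexConj L) 3 ((StdForm.antidiagonal 3).over L) 𝔫 → u ≠ b * k) → Φf u = 0)
    (kf : ↥(finAdelic (↥(maximalRealSubfield L)) L (IsCMField.complexConj L) 3 ((StdForm.antidiagonal 3).over L)))
    (ω : ∀ v : HeightOneSpectrum (𝓞 ↥(maximalRealSubfield L)), (Fin 3 → v.adicCompletion ↥(maximalRealSubfield L)) → ℂ)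
    (hω : ∀ (v : HeightOneSpectrum (𝓞 ↥(maximalRealSubfield L))) (x : Fin 3 → FiniteAdeleRing (𝓞 ↥(maximalRealSubfield L)) ↥(maximalRealSubfield L)),
      ω v (fun i => x i v) = Φf (inclPlace (↥(maximalRealSubfield L)) L (IsCMField.complexConj L) 3 ((StdForm.antidiagonal 3).over L) v
        (evalPlace (↥(maximalRealSubfield L)) L (IsCMField.complexConj L) 3 ((StdForm.antidiagonal 3).over L) v
          (finPart (↥(maximalRealSubfield L)) L (IsCMField.complexConj L) 3 ((StdForm.antidiagonal 3).over L)
            ((quasiSplit (↥(maximalRealSubfield L)) L (IsCMField.complexConj L) 3).toAdelic (weylLongU ((IsCMField.complexConj L : L ≃ₐ[↥(maximalRealSubfield L)] L) : L →+* L) (rfl : (StdForm.antidiagonal 3).over L = (StdForm.antidiagonal 3).over L)) *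
              ((heisChart hc (((((0 : InfiniteAdeleRing L)), quadraticFiniteAdeleMap ↥(maximalRealSubfield L) L δ (x 0, x 1)) : AdeleRing (𝓞 L) L),
                traceZeroLine ↥(maximalRealSubfield L) L (IsCMField.complexConj L) hcδ hδ ((0, x 2) : AdeleRing (𝓞 ↥(maximalRealSubfield L)) ↥(maximalRealSubfield L))) :
                  ↥(adelicUnipotent ↥(maximalRealSubfield L) L (IsCMField.complexConj L) 3)) : (quasiSplit (↥(maximalRealSubfield L)) L (IsCMField.complexConj L) 3).Adelic)) * kf)))) :
    ∀ x : Fin 3 → FiniteAdeleRing (𝓞 ↥(maximalRealSubfield L)) ↥(maximalRealSubfield L),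
      Φf (finPart (↥(maximalRealSubfield L)) L (IsCMField.complexConj L) 3 ((StdForm.antidiagonal 3).over L)
          ((quasiSplit (↥(maximalRealSubfield L)) L (IsCMField.complexConj L) 3).toAdelic (weylLongU ((IsCMField.complexConj L : L ≃ₐ[↥(maximalRealSubfield L)] L) : L →+* L) (rfl : (StdForm.antidiagonal 3).over L = (StdForm.antidiagonal 3).over L)) *
            ((heisChart hc (((((0 : InfiniteAdeleRing L)), quadraticFiniteAdeleMap ↥(maximalRealSubfield L) L δ (x 0, x 1)) : AdeleRing (𝓞 L) L),
              traceZeroLine ↥(maximalRealSubfield L) L (IsCMField.complexConj L) hcδ hδ ((0, x 2) : AdeleRing (𝓞 ↥(maximalRealSubfield L)) ↥(maximalRealSubfield L))) :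
                ↥(adelicUnipotent ↥(maximalRealSubfield L) L (IsCMField.complexConj L) 3)) : (quasiSplit (↥(maximalRealSubfield L)) L (IsCMField.complexConj L) 3).Adelic)) * kf) =
        ∏ᶠ v : HeightOneSpectrum (𝓞 ↥(maximalRealSubfield L)), ω v (fun i => x i v) := by
  classical
  refine hΩ_of_localReadings L χ 𝔫 Φf hon hoff _ ω fun x v => ?_
  by_cases h : ∃ β κ : localPi L (IsCMField.complexConj L) 3 ((StdForm.antidiagonal 3).over L) v,
      (∀ w : PlacesOver L v, ((((β : localPi L (IsCMField.complexConj L) 3 ((StdForm.antidiagonal 3).over L) v) : LocalGLPi L 3 v) w : GL (Fin 3) (w.1.adicCompletion L)) :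
        Matrix (Fin 3) (Fin 3) (w.1.adicCompletion L)).BlockTriangular id) ∧
      (∀ w : PlacesOver L v, ((κ : localPi L (IsCMField.complexConj L) 3 ((StdForm.antidiagonal 3).over L) v) : LocalGLPi L 3 v) w ∈ valuedCongruenceSubgroup (Fin 3) (idealRadius L w.1 𝔫)) ∧
      evalPlace (↥(maximalRealSubfield L)) L (IsCMField.complexConj L) 3 ((StdForm.antidiagonal 3).over L) v
        (finPart (↥(maximalRealSubfield L)) L (IsCMField.complexConj L) 3 ((StdForm.antidiagonal 3).over L)
          ((quasiSplit (↥(maximalRealSubfield L)) L (IsCMField.complexConj L) 3).toAdelic (weylLongU ((IsCMField.complexConj L : L ≃ₐ[↥(maximalRealSubfield L)] L) : L →+* L) (rfl : (StdForm.antidiagonal 3).over L = (StdForm.antidiagonal 3).over L)) *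
            ((heisChart hc (((((0 : InfiniteAdeleRing L)), quadraticFiniteAdeleMap ↥(maximalRealSubfield L) L δ (x 0, x 1)) : AdeleRing (𝓞 L) L),
              traceZeroLine ↥(maximalRealSubfield L) L (IsCMField.complexConj L) hcδ hδ ((0, x 2) : AdeleRing (𝓞 ↥(maximalRealSubfield L)) ↥(maximalRealSubfield L))) :
                ↥(adelicUnipotent ↥(maximalRealSubfield L) L (IsCMField.complexConj L) 3)) : (quasiSplit (↥(maximalRealSubfield L)) L (IsCMField.complexConj L) 3).Adelic)) * kf) = β * κ
  · -- «on» at `v`: the local units `t_w := (β_w)₀₀` and §2's reading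
    obtain ⟨β, κ, hβ, hκ, hprod⟩ := h
    refine Or.inl ⟨β, κ, fun w => Units.mk0 _ (apply_diag_ne_zero_of_blockTriangular (hβ w) 0), hβ, hκ, hprod, fun w => rfl, ?_⟩
    rw [hω]
    exact apply_inclPlace_eq_prod_of_eq_mul L χ 𝔫 Φf v hon β κ hβ hκ hprod _ fun w => rfl
  · -- «off» at `v`: the factor vanishes; finite support from the eventual integrality of the big cell
    refine Or.inr ⟨fun β κ hβ hκ hprod => h ⟨β, κ, hβ, hκ, hprod⟩, ?_, ?_⟩
    · rw [hω]
      exact apply_inclPlace_eq_zero_of_forall_ne L 𝔫 Φf v hoff fun β κ hβ hκ hprod => h ⟨β, κ, hβ, hκ, hprod⟩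
    · have hev := eventually_forall_evalPlace_mem_valuedCongruenceSubgroup (↥(maximalRealSubfield L)) L (IsCMField.complexConj L) 3 ((StdForm.antidiagonal 3).over L) h𝔫
        (finPart (↥(maximalRealSubfield L)) L (IsCMField.complexConj L) 3 ((StdForm.antidiagonal 3).over L)
          ((quasiSplit (↥(maximalRealSubfield L)) L (IsCMField.complexConj L) 3).toAdelic (weylLongU ((IsCMField.complexConj L : L ≃ₐ[↥(maximalRealSubfield L)] L) : L →+* L) (rfl : (StdForm.antidiagonal 3).over L = (StdForm.antidiagonal 3).over L)) *
            ((heisChart hc (((((0 : InfiniteAdeleRing L)), quadraticFiniteAdeleMap ↥(maximalRealSubfield L) L δ (x 0, x 1)) : AdeleRing (𝓞 L) L),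
              traceZeroLine ↥(maximalRealSubfield L) L (IsCMField.complexConj L) hcδ hδ ((0, x 2) : AdeleRing (𝓞 ↥(maximalRealSubfield L)) ↥(maximalRealSubfield L))) :
                ↥(adelicUnipotent ↥(maximalRealSubfield L) L (IsCMField.complexConj L) 3)) : (quasiSplit (↥(maximalRealSubfield L)) L (IsCMField.complexConj L) 3).Adelic)) * kf)
      refine (Filter.eventually_cofinite.1 hev).subset fun v' hv' => ?_
      intro hall
      exact hv' (show ω v' (fun i => x i v') = 1 by rw [hω]; exact apply_inclPlace_eq_one_of_mem_level L χ 𝔫 Φf v' hon hall)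

end Descriptive

end Summit.HodgeConjecture.HodgeConjecture.Cruxes.H413.K2E1ChiDescriptiveWeightU3

end
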